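import Summits.BirchSwinnertonDyer.Rank2.LevelFifteenManinSymbols
import Literature.NumberTheory.Automorphic.GammaTwoGenerators
import HarnessLib

/-!
# Route `ResidualThetaTransportAtTwo`, crux Kμ⁺ `SignedMuVanishingAtTwoPlus` (stmt-BirchSwinnertonDyer-20689),
# line `birth`, stub `stub_flatMuZeroAtTwo`: `4^k`-WORDS — the `2 × 2` bookkeeping and the four membership lemmas
# behind «the `4^k`-elements generate `Γ₀(p)`» (sequel: `…CuspSpanFourPowGenerate`, `…CuspSpanPrimeLevel`)

Cell `bsd-wall`, lead `bsd-wall-rtt-p4` (g6). THEOREMS ONLY (no `def`, no named fact, no `sorry`); helper `--supports`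
the crux; BSD is not proved by this.

Context: the analytic research residue of line `birth` is, per level `N`, the curve-free predicate
`CuspSpanEvenAtTwo N` ((G′)_N), reduced by width seat w3 g3 to the inclusion `Γ₁'(N) ≤ M_N` where `M_N ≤ Γ₀(N)` is
generated by small-trace elements, the `4^k`-elements (lower-right entry `±4^k`, `k ≥ 1`), squares and commutators
(`cuspSpanEvenAtTwo_of_gamma1_le_closure`, p596882). The lead's route to an infinite family of levels: at a prime
`p` with `⟨−1, 4⟩ = (ℤ/p)ˣ` the `4^k`-elements alone generate `Γ₀(p)` (Reidemeister–Schreier with Rademacher's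
transversal `{1} ∪ {S T^ℓ}`, lifts `ℓ ∈ {0} ∪ ±4^ℕ⁺`). This file supplies, for an arbitrary subgroup `K ≤ SL(2, ℤ)`
containing the `4^k`-elements of `Γ₀(p)` (`4` a unit mod `p`):

* §1 bottom rows of `g T^n`, `−g` (for `g S`: `LevelFifteen.mul_S_apply_10/11`; `S T^m S⁻¹ = (1 0; −m 1)`:
  `GammaTwo.coe_S_mul_T_zpow_mul_S_inv`; `S⁻¹ = −S`: Mathlib `ModularGroup.S_inv`); the Rademacher word
  `S T^ℓ S T^{−ℓ'} S⁻¹ = (−ℓ' −1; ℓℓ'+1 ℓ)`; the bottom row of `g ∈ SL(2, ℤ)` is non-zero mod `p`.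
* §2 `exists_gamma0_apply_one_one_eq_four` (a `γ₀ ∈ Γ₀(p)` with `d = 4`), `T_mem_of_fourPow_mem`
  (`T = (Tγ₀)γ₀⁻¹ ∈ K`), `neg_one_mem_of_fourPow_mem` (`−1 = (−γ₀)γ₀⁻¹ ∈ K`),
  `S_mul_T_zpow_mul_S_inv_mem_of_fourPow_mem` (`(1 0; −m 1) ∈ K` for `p ∣ m`: `γ₀ (1 0; −m 1)` is a `4`-element),
  `rademacherWord_mem_of_fourPow_mem` (`S T^ℓ S T^{−ℓ'} S⁻¹ ∈ K` for `|ℓ| = 4^k`, `ℓℓ' ≡ −1`).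

References: H. Rademacher, Abh. Math. Sem. Hamburg 7 (1929) 134–148 [Rademacher1929]; A. W. Knapp, *Elliptic
curves* (1992) Prop. 11.22 [Knapp1993].
-/

set_option autoImplicit false
set_option linter.dupNamespace false

noncomputable section

open scoped Classical MatrixGroups

open CongruenceSubgroup Matrix.SpecialLinearGroup ModularGroup Literature.NumberTheory.Automorphic
  Summit.BirchSwinnertonDyer.Rank2.LevelFifteen

namespace Summit.BirchSwinnertonDyer.BirchSwinnertonDyer.Theorems.SignedMuAtTwo

/-! ## §1. Matrix bookkeeping in `SL(2, ℤ)`: bottom rows of `g T^n`, `−g`; the Rademacher word `S T^ℓ S T^{−ℓ'} S⁻¹` -/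

section Entries

/-- Bottom-left entry of `g T^n` is that of `g`. [folklore] -/
theorem mul_T_zpow_apply_one_zero (g : SL(2, ℤ)) (n : ℤ) : (g * T ^ n) 1 0 = g 1 0 := by
  rw [coe_mul, coe_T_zpow]
  simp [Matrix.mul_apply, Fin.sum_univ_two]

/-- Bottom-right entry of `g T^n` is `c n + d`. [folklore] -/
theorem mul_T_zpow_apply_one_one (g : SL(2, ℤ)) (n : ℤ) : (g * T ^ n) 1 1 = g 1 0 * n + g 1 1 := by
  rw [coe_mul, coe_T_zpow]
  simp [Matrix.mul_apply, Fin.sum_univ_two]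

/-- Entries of `−g`. [folklore] -/
theorem neg_apply (g : SL(2, ℤ)) (i j : Fin 2) : (-g) i j = -(g i j) := by
  rw [coe_neg]
  rfl

/-- `g S⁻¹ = −(g S)`. [folklore] -/
theorem mul_S_inv_eq_neg (g : SL(2, ℤ)) : g * S⁻¹ = -(g * S) := by
  rw [S_inv, mul_neg]

/-- The Rademacher word `S T^ℓ S T^{−ℓ'} S⁻¹ = (−ℓ' −1; ℓℓ'+1 ℓ)`. [folklore] -/
theorem coe_rademacherWord (ℓ ℓ' : ℤ) :
    ((S * T ^ ℓ * S * T ^ (-ℓ') * S⁻¹ : SL(2, ℤ)) : Matrix (Fin 2) (Fin 2) ℤ) =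
      !![-ℓ', -1; ℓ * ℓ' + 1, ℓ] := by
  rw [coe_mul, coe_mul, coe_mul, coe_mul, coe_inv, coe_T_zpow, coe_T_zpow, coe_S, Matrix.adjugate_fin_two]
  ext i j
  fin_cases i <;> fin_cases j <;> simp [Matrix.mul_apply, Fin.sum_univ_two]
  ring

/-- The bottom row of an element of `SL(2, ℤ)` does not vanish modulo a prime. [folklore] -/
theorem not_cast_apply_one_zero_eq_zero_and {p : ℕ} [Fact p.Prime] (g : SL(2, ℤ)) :
    ¬ (((g 1 0 : ℤ) : ZMod p) = 0 ∧ ((g 1 1 : ℤ) : ZMod p) = 0) := by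
  rintro ⟨h0, h1⟩
  have hdet : (g 0 0 : ℤ) * g 1 1 - g 0 1 * g 1 0 = 1 := by
    have := Matrix.SpecialLinearGroup.det_coe g
    rwa [Matrix.det_fin_two] at this
  have := congrArg (fun z : ℤ ↦ (z : ZMod p)) hdet
  simp only [Int.cast_sub, Int.cast_mul, Int.cast_one, h0, h1, mul_zero, sub_zero] at this
  exact zero_ne_one this

end Entries

/-! ## §2. The `4^k`-elements generate: `T`, `−1`, the lower unipotents `S T^{pm} S⁻¹` and the Rademacher words
`S T^{±4^k} S T^{−ℓ'} S⁻¹` lie in any subgroup containing the `4^k`-elements of `Γ₀(p)` -/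

section Generation

variable {p : ℕ} {K : Subgroup SL(2, ℤ)}

/-- **The Rademacher words `S T^ℓ S T^{−ℓ'} S⁻¹` with `|ℓ| = 4^k` (`k ≥ 1`) and `ℓ ℓ' ≡ −1 (mod p)` are
`4^k`-elements of `Γ₀(p)`** (lower row `(ℓℓ' + 1, ℓ)`). [folklore] -/
theorem rademacherWord_mem_of_fourPow_mem
    (hK : ∀ γ : SL(2, ℤ), γ ∈ Gamma0 p → (∃ k : ℕ, 1 ≤ k ∧ (γ 1 1).natAbs = 4 ^ k) → γ ∈ K)
    {ℓ ℓ' : ℤ} (hℓ : ∃ k : ℕ, 1 ≤ k ∧ ℓ.natAbs = 4 ^ k) (hcong : ((ℓ * ℓ' + 1 : ℤ) : ZMod p) = 0) :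
    (S * T ^ ℓ * S * T ^ (-ℓ') * S⁻¹ : SL(2, ℤ)) ∈ K := by
  refine hK _ ?_ ?_
  · rw [Gamma0_mem, coe_rademacherWord]
    simpa using hcong
  · rw [coe_rademacherWord]
    simpa using hℓ

variable [Fact p.Prime]

/-- **A base `4`-element.** If `4` is a unit mod `p` there is `γ₀ ∈ Γ₀(p)` with lower-right entry `4` (namely
`S T⁴ S T^{b} S⁻¹` with `4b ≡ 1`). [folklore] -/
theorem exists_gamma0_apply_one_one_eq_four (h4 : IsUnit (4 : ZMod p)) :
    ∃ γ₀ : SL(2, ℤ), γ₀ ∈ Gamma0 p ∧ γ₀ 1 1 = 4 := by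
  obtain ⟨b, hb⟩ := h4.exists_right_inv
  refine ⟨S * T ^ (4 : ℤ) * S * T ^ (-(-(b.val : ℤ))) * S⁻¹, ?_, ?_⟩
  · rw [Gamma0_mem, coe_rademacherWord]
    simp only [Matrix.of_apply, Matrix.cons_val', Matrix.cons_val_zero, Matrix.cons_val_one,
      Matrix.cons_val_fin_one, Int.cast_add, Int.cast_mul, Int.cast_neg, Int.cast_ofNat, Int.cast_natCast,
      Int.cast_one, ZMod.natCast_zmod_val]
    linear_combination (-1 : ZMod p) * hb
  · rw [coe_rademacherWord]
    simp

/-- **`T` is a quotient of two `4^k`-elements**: `T = (T γ₀) γ₀⁻¹`, and `T γ₀` has the same bottom row as `γ₀`.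
[folklore] -/
theorem T_mem_of_fourPow_mem (h4 : IsUnit (4 : ZMod p))
    (hK : ∀ γ : SL(2, ℤ), γ ∈ Gamma0 p → (∃ k : ℕ, 1 ≤ k ∧ (γ 1 1).natAbs = 4 ^ k) → γ ∈ K) :
    (T : SL(2, ℤ)) ∈ K := by
  obtain ⟨γ₀, hγ₀, hd⟩ := exists_gamma0_apply_one_one_eq_four h4
  have hrow : ∀ j : Fin 2, (T * γ₀) 1 j = γ₀ 1 j := by
    intro j
    rw [coe_mul, coe_T]
    simp [Matrix.mul_apply, Fin.sum_univ_two]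
  have h1 : T * γ₀ ∈ K := by
    refine hK _ ?_ ⟨1, le_rfl, ?_⟩
    · rw [Gamma0_mem] at hγ₀ ⊢
      rw [hrow]; exact hγ₀
    · rw [hrow, hd]; rfl
  have h2 : γ₀ ∈ K := hK _ hγ₀ ⟨1, le_rfl, by rw [hd]; rfl⟩
  simpa using K.mul_mem h1 (K.inv_mem h2)

/-- **`−1` is a quotient of two `4^k`-elements**: `−1 = (−γ₀) γ₀⁻¹`. [folklore] -/
theorem neg_one_mem_of_fourPow_mem (h4 : IsUnit (4 : ZMod p))
    (hK : ∀ γ : SL(2, ℤ), γ ∈ Gamma0 p → (∃ k : ℕ, 1 ≤ k ∧ (γ 1 1).natAbs = 4 ^ k) → γ ∈ K) :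
    (-1 : SL(2, ℤ)) ∈ K := by
  obtain ⟨γ₀, hγ₀, hd⟩ := exists_gamma0_apply_one_one_eq_four h4
  have h1 : -γ₀ ∈ K := by
    refine hK _ ?_ ⟨1, le_rfl, ?_⟩
    · rw [Gamma0_mem] at hγ₀ ⊢
      rw [neg_apply, Int.cast_neg, hγ₀, neg_zero]
    · rw [neg_apply, hd]; rfl
  have h2 : γ₀ ∈ K := hK _ hγ₀ ⟨1, le_rfl, by rw [hd]; rfl⟩
  have : -γ₀ * γ₀⁻¹ = -1 := by rw [neg_mul, mul_inv_cancel]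
  rw [← this]
  exact K.mul_mem h1 (K.inv_mem h2)

/-- **The lower unipotents `S T^{m} S⁻¹ = (1 0; −m 1)` with `p ∣ m` are quotients of two `4^k`-elements**:
`γ₀ · (S T^m S⁻¹)` has the same lower-right entry `4` as `γ₀` and lower-left entry `≡ 0`. [folklore] -/
theorem S_mul_T_zpow_mul_S_inv_mem_of_fourPow_mem (h4 : IsUnit (4 : ZMod p))
    (hK : ∀ γ : SL(2, ℤ), γ ∈ Gamma0 p → (∃ k : ℕ, 1 ≤ k ∧ (γ 1 1).natAbs = 4 ^ k) → γ ∈ K)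
    {m : ℤ} (hm : (m : ZMod p) = 0) : (S * T ^ m * S⁻¹ : SL(2, ℤ)) ∈ K := by
  obtain ⟨γ₀, hγ₀, hd⟩ := exists_gamma0_apply_one_one_eq_four h4
  have h10 : (γ₀ * (S * T ^ m * S⁻¹)) 1 0 = γ₀ 1 0 - 4 * m := by
    rw [coe_mul, GammaTwo.coe_S_mul_T_zpow_mul_S_inv]
    simp [Matrix.mul_apply, Fin.sum_univ_two, hd]
    ring
  have h11 : (γ₀ * (S * T ^ m * S⁻¹)) 1 1 = 4 := by
    rw [coe_mul, GammaTwo.coe_S_mul_T_zpow_mul_S_inv]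
    simp [Matrix.mul_apply, Fin.sum_univ_two, hd]
  have h1 : γ₀ * (S * T ^ m * S⁻¹) ∈ K := by
    refine hK _ ?_ ⟨1, le_rfl, by rw [h11]; rfl⟩
    rw [Gamma0_mem] at hγ₀ ⊢
    rw [h10, Int.cast_sub, Int.cast_mul, hγ₀, hm, mul_zero, sub_zero]
  have h2 : γ₀ ∈ K := hK _ hγ₀ ⟨1, le_rfl, by rw [hd]; rfl⟩
  simpa using K.mul_mem (K.inv_mem h2) h1

end Generation

end Summit.BirchSwinnertonDyer.BirchSwinnertonDyer.Theorems.SignedMuAtTwo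

end
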